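import Literature.Topology.FourManifolds.LefschetzHandlebody
import Literature.Topology.FourManifolds.TwoHandleTubeCoordinates
import Literature.AlgebraicTopology.FundamentalGroup.CellAttachmentKernelLoop
import Literature.AlgebraicTopology.FundamentalGroup.CircleAndTorus
import Literature.AlgebraicTopology.SingularHomology.LoopClassesSpan
import Summits.SmoothPoincare4.SmoothPoincare4.Theorems.ConvexBisectionAcyclicBisectionExistsMultiAttachmentHomologyLoops
import Summits.SmoothPoincare4.SmoothPoincare4.Theorems.ConvexBisectionAcyclicBisectionExistsMultiAttachmentH1Model
import Summits.SmoothPoincare4.SmoothPoincare4.Theorems.ConvexBisectionAcyclicBisectionExistsKasSeamCover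
import HarnessLib

/-!
# The tube seam `(T ∖ S) ∩ S³ ≅ T² × ℝ`: path connected, `H₁` spanned by the meridian and the
# longitude
(helper for stub `stub_modelsOn_counts` = NF2, clause 3 = Kas' presentation of `H₁(∂X(F; l); ℤ)`;
line `modp-braid-orbits` r9, crux `ConvexBisection.AcyclicBisectionExists`, item
stmt-SmoothPoincare4-10508; wave 4 / W4-D, design lemma (D-tube) `Kas_tubeSeam_homology` of
`work/stubs/Kas_Design.lean`.)

`tubeSeam = {x ∈ S³ : 0 < |x_λ| < 1}` (`…KasSeamCover.lean`) deformation retracts onto the CLIFFORD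
TORUS (§1, `cliffHomotopy : id ≃ cliff ∘ angs`, `angs x = (x_λ/|x_λ|, x_μ/|x_μ|)`), so `H₁(tubeSeam; ℤ)`
comes from `H₁(𝕊¹ × 𝕊¹)`; by Hurewicz (`HurewiczProof.span_loopClass_eq_top`) and
`π₁(𝕊¹ × 𝕊¹) = π₁(𝕊¹) × π₁(𝕊¹)` (`fundamentalGroupProdEquiv`, Hatcher Prop. 1.12) with `π₁(𝕊¹)` generated
by the simple closed curve `circlePt` (`zpowers_liftPath_eq_top_of_simpleClosed`, Thm. 1.7), every
class is `a[(b₀, ω)] + b[(ω, b₀)]` (§2), i.e. `a[meridian] + b[longitude]`.  §3: `Kas_tubeSeam_homology`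
(design statement) = registered sub-goal stub `stub_Kas_tubeSeam_homology`.  Everything is proved; no
named facts, no `sorry`.  References: A. Kas, Pacific J. Math. 89 (1980) [Kas1980]; A. Hatcher,
*Algebraic Topology* (2002), Thm. 1.7, Prop. 1.12, Thm. 2A.1 [HatcherAT2002].
-/

noncomputable section

-- the prescribed namespace `Summit.<P>.<Sub>.…` duplicates `SmoothPoincare4` (P = Sub)
set_option linter.dupNamespace false

open scoped Manifold ContDiff Topology unitInterval
open Set Function Metric CategoryTheory
open Literature.Topology.FourManifolds Literature.Topology.FourManifolds.LefschetzBase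
  Literature.AlgebraicTopology.SingularHomology Literature.Topology.FourManifolds.HandleAttachingMap
  Literature.AlgebraicTopology.FundamentalGroup Literature.AlgebraicTopology.FundamentalGroup.VanKampen

namespace Summit.SmoothPoincare4.SmoothPoincare4.Theorems.AcyclicBisectionExists.ModpBraidOrbits

/-! ## §1 Coordinates, the Clifford torus, the angles, the deformation -/

section Deformation

/-- The vector of `ℝ⁴` underlying a point of the tube seam. [folklore] -/
def vecT (y : ↥tubeSeam) : EuclideanSpace ℝ (Fin 4) :=
  (((y : ↥(handleTube 3 2)) : closedBall (0 : EuclideanSpace ℝ (Fin 4)) 1) : EuclideanSpace ℝ (Fin 4))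

/-- `vecT` is continuous. [folklore] -/
theorem continuous_vecT : Continuous vecT :=
  continuous_subtype_val.comp (continuous_subtype_val.comp continuous_subtype_val)

/-- `‖x_λ‖² + ‖x_μ‖² = 1` on the tube seam. [folklore] -/
theorem norm_lam_sq_add_norm_mu_sq_T (y : ↥tubeSeam) :
    ‖lamPart₂ 2 (vecT y)‖ ^ 2 + ‖muPartG 2 (vecT y)‖ ^ 2 = 1 := by
  rw [← norm_sq_eq_lamPart₂_muPartG, show ‖vecT y‖ = 1 from y.2.1, one_pow]

/-- `0 < ‖x_λ‖² < 1` on the tube seam. [folklore] -/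
theorem norm_lam_sq_T (y : ↥tubeSeam) :
    0 < ‖lamPart₂ 2 (vecT y)‖ ^ 2 ∧ ‖lamPart₂ 2 (vecT y)‖ ^ 2 < 1 := by
  rw [← lamSq_two_eq]
  exact ⟨lt_of_le_of_ne (lamSq_nonneg 2 _) (Ne.symm (y : ↥(handleTube 3 2)).2),
    lt_of_le_of_ne (lamSq_le_one (le_of_eq y.2.1)) y.2.2⟩

/-- `‖x_λ‖ > 0` and `‖x_μ‖ > 0` on the tube seam. [folklore] -/
theorem norm_parts_pos_T (y : ↥tubeSeam) : 0 < ‖lamPart₂ 2 (vecT y)‖ ∧ 0 < ‖muPartG 2 (vecT y)‖ := by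
  obtain ⟨h2, h3⟩ := norm_lam_sq_T y
  have h4 : 0 < ‖muPartG 2 (vecT y)‖ ^ 2 := by linarith [norm_lam_sq_add_norm_mu_sq_T y]
  exact ⟨lt_of_le_of_ne (norm_nonneg _) fun h => by rw [← h] at h2; norm_num at h2,
    lt_of_le_of_ne (norm_nonneg _) fun h => by rw [← h] at h4; norm_num at h4⟩

/-- A point of the tube seam from `u ⊕ v` with `‖u‖² + ‖v‖² = 1`, `0 < ‖u‖² < 1`. [folklore] -/
def mkT (u v : EuclideanSpace ℝ (Fin 2)) (h1 : ‖u‖ ^ 2 + ‖v‖ ^ 2 = 1) (hu0 : 0 < ‖u‖ ^ 2)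
    (hu1 : ‖u‖ ^ 2 < 1) : ↥tubeSeam :=
  have hn : ‖lamEmbed₂ 2 u + muEmbedG 2 v‖ = 1 := by
    have h := norm_lamEmbed₂_add_muEmbedG_sq (m := 2) u v
    rw [h1] at h
    nlinarith [norm_nonneg (lamEmbed₂ 2 u + muEmbedG 2 v)]
  have hl : lamSq 2 (lamEmbed₂ 2 u + muEmbedG 2 v) = ‖u‖ ^ 2 := by
    rw [lamSq_two_eq, map_add, lamPart₂_lamEmbed₂, lamPart₂_muEmbedG, add_zero]
  ⟨⟨⟨lamEmbed₂ 2 u + muEmbedG 2 v, mem_closedBall_zero_iff.2 hn.le⟩, by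
    rw [mem_handleTube]
    show lamSq 2 (lamEmbed₂ 2 u + muEmbedG 2 v) ≠ 0
    rw [hl]; exact hu0.ne'⟩, hn, by
    show lamSq 2 (lamEmbed₂ 2 u + muEmbedG 2 v) ≠ 1
    rw [hl]; exact hu1.ne⟩

/-- Points of the tube seam with the same vector are equal. [folklore] -/
theorem ext_vecT {y y' : ↥tubeSeam} (h : vecT y = vecT y') : y = y' :=
  Subtype.ext (Subtype.ext (Subtype.ext h))

/-- The Clifford vector in `ℝ²_λ × ℝ²_μ`: `(θ, φ)/√2 = (θ/√2, 0) + (0, φ/√2)`. [folklore] -/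
theorem cliffordVec_eq (θ φ : sphere (0 : EuclideanSpace ℝ (Fin 2)) 1) :
    cliffordVec θ φ = lamEmbed₂ 2 ((Real.sqrt 2)⁻¹ • (θ : EuclideanSpace ℝ (Fin 2))) +
      muEmbedG 2 ((Real.sqrt 2)⁻¹ • (φ : EuclideanSpace ℝ (Fin 2))) := by
  ext i
  fin_cases i <;> simp [cliffordVec, lamEmbed₂_apply, muEmbedG_apply, div_eq_inv_mul]

/-- **The Clifford torus** `(θ, φ) ↦ (θ, φ)/√2` in the tube seam. [cite: GompfStipsicz1999, §8.2] -/
def cliff : C(sphere (0 : EuclideanSpace ℝ (Fin 2)) 1 × sphere (0 : EuclideanSpace ℝ (Fin 2)) 1, ↥tubeSeam) where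
  toFun p := ⟨cliffordPt p.1 p.2, cliffordPt_mem_tubeSeam p.1 p.2⟩
  continuous_toFun := continuous_cliffordPt.subtype_mk _

/-- **The two angles** `x ↦ (x_λ/|x_λ|, x_μ/|x_μ|)` of the tube seam. [cite: GompfStipsicz1999, §8.2] -/
def angs : C(↥tubeSeam, sphere (0 : EuclideanSpace ℝ (Fin 2)) 1 × sphere (0 : EuclideanSpace ℝ (Fin 2)) 1) where
  toFun y := (⟨‖lamPart₂ 2 (vecT y)‖⁻¹ • lamPart₂ 2 (vecT y), by
      rw [mem_sphere_zero_iff_norm, norm_smul, norm_inv, norm_norm,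
        inv_mul_cancel₀ (norm_parts_pos_T y).1.ne']⟩,
    ⟨‖muPartG 2 (vecT y)‖⁻¹ • muPartG 2 (vecT y), by
      rw [mem_sphere_zero_iff_norm, norm_smul, norm_inv, norm_norm,
        inv_mul_cancel₀ (norm_parts_pos_T y).2.ne']⟩)
  continuous_toFun := by
    have hp : Continuous fun y => lamPart₂ 2 (vecT y) := (lamPart₂ 2).continuous.comp continuous_vecT
    have hq : Continuous fun y => muPartG 2 (vecT y) := (muPartG 2).continuous.comp continuous_vecT
    exact ((hp.norm.inv₀ fun y => (norm_parts_pos_T y).1.ne').smul hp).subtype_mk _ |>.prodMk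
      (((hq.norm.inv₀ fun y => (norm_parts_pos_T y).2.ne').smul hq).subtype_mk _)

/-- The radii `c_t² = (1−t)‖x_λ‖² + t/2`, `s_t² = (1−t)‖x_μ‖² + t/2`: positive, sum `1`. [folklore] -/
theorem radii_T {t : ℝ} (ht0 : 0 ≤ t) (ht1 : t ≤ 1) (y : ↥tubeSeam) :
    0 < (1 - t) * ‖lamPart₂ 2 (vecT y)‖ ^ 2 + t / 2 ∧ 0 < (1 - t) * ‖muPartG 2 (vecT y)‖ ^ 2 + t / 2 ∧
    ((1 - t) * ‖lamPart₂ 2 (vecT y)‖ ^ 2 + t / 2) + ((1 - t) * ‖muPartG 2 (vecT y)‖ ^ 2 + t / 2) = 1 := by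
  have h1 := norm_lam_sq_add_norm_mu_sq_T y
  obtain ⟨h2, h3⟩ := norm_lam_sq_T y
  have h4 : 0 < ‖muPartG 2 (vecT y)‖ ^ 2 := by linarith
  refine ⟨?_, ?_, by nlinarith⟩
  · rcases eq_or_lt_of_le ht1 with rfl | hlt
    · norm_num
    · nlinarith
  · rcases eq_or_lt_of_le ht1 with rfl | hlt
    · norm_num
    · nlinarith

/-- `‖(√a/‖w‖) • w‖² = a` for `w ≠ 0`, `a ≥ 0`. [folklore] -/
theorem norm_sqrt_div_smul_sq {a : ℝ} (ha : 0 ≤ a) {w : EuclideanSpace ℝ (Fin 2)} (hw : 0 < ‖w‖) :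
    ‖(Real.sqrt a / ‖w‖) • w‖ ^ 2 = a := by
  rw [norm_smul, norm_div, Real.norm_eq_abs, abs_of_nonneg (Real.sqrt_nonneg _), norm_norm,
    div_mul_cancel₀ _ hw.ne', Real.sq_sqrt ha]

/-- The `λ`-part `c_t x_λ/|x_λ|` of the deformation. [folklore] -/
def defLamT (t : ℝ) (y : ↥tubeSeam) : EuclideanSpace ℝ (Fin 2) :=
  (Real.sqrt ((1 - t) * ‖lamPart₂ 2 (vecT y)‖ ^ 2 + t / 2) / ‖lamPart₂ 2 (vecT y)‖) • lamPart₂ 2 (vecT y)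

/-- The `μ`-part `s_t x_μ/|x_μ|` of the deformation. [folklore] -/
def defMuT (t : ℝ) (y : ↥tubeSeam) : EuclideanSpace ℝ (Fin 2) :=
  (Real.sqrt ((1 - t) * ‖muPartG 2 (vecT y)‖ ^ 2 + t / 2) / ‖muPartG 2 (vecT y)‖) • muPartG 2 (vecT y)

/-- **The deformed point** `G_t(x)` of the tube seam. [folklore] -/
def defPtT (t : I) (y : ↥tubeSeam) : ↥tubeSeam :=
  mkT (defLamT t y) (defMuT t y)
    (by
      rw [defLamT, defMuT, norm_sqrt_div_smul_sq (radii_T t.2.1 t.2.2 y).1.le (norm_parts_pos_T y).1,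
        norm_sqrt_div_smul_sq (radii_T t.2.1 t.2.2 y).2.1.le (norm_parts_pos_T y).2]
      exact (radii_T t.2.1 t.2.2 y).2.2)
    (by
      rw [defLamT, norm_sqrt_div_smul_sq (radii_T t.2.1 t.2.2 y).1.le (norm_parts_pos_T y).1]
      exact (radii_T t.2.1 t.2.2 y).1)
    (by
      rw [defLamT, norm_sqrt_div_smul_sq (radii_T t.2.1 t.2.2 y).1.le (norm_parts_pos_T y).1]
      linarith [(radii_T t.2.1 t.2.2 y).2.1, (radii_T t.2.1 t.2.2 y).2.2])

/-- The vector of the deformed point. [folklore] -/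
theorem vecT_defPtT (t : I) (y : ↥tubeSeam) :
    vecT (defPtT t y) = lamEmbed₂ 2 (defLamT t y) + muEmbedG 2 (defMuT t y) := rfl

/-- **The deformation of the tube seam onto the Clifford torus** `id ≃ cliff ∘ angs`. [cite: GompfStipsicz1999, §8.2] -/
def cliffHomotopy : (ContinuousMap.id ↥tubeSeam).Homotopy (cliff.comp angs) where
  toFun p := defPtT p.1 p.2
  continuous_toFun := by
    refine Continuous.subtype_mk (Continuous.subtype_mk (Continuous.subtype_mk ?_ _) _) _
    show Continuous fun p : I × ↥tubeSeam =>
      lamEmbed₂ 2 (defLamT (p.1 : ℝ) p.2) + muEmbedG 2 (defMuT (p.1 : ℝ) p.2)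
    unfold defLamT defMuT
    have ht : Continuous fun p : I × ↥tubeSeam => ((p.1 : I) : ℝ) :=
      continuous_subtype_val.comp continuous_fst
    have hp : Continuous fun p : I × ↥tubeSeam => lamPart₂ 2 (vecT p.2) :=
      (lamPart₂ 2).continuous.comp (continuous_vecT.comp continuous_snd)
    have hq : Continuous fun p : I × ↥tubeSeam => muPartG 2 (vecT p.2) :=
      (muPartG 2).continuous.comp (continuous_vecT.comp continuous_snd)
    have hc1 : Continuous fun p : I × ↥tubeSeam =>
        Real.sqrt ((1 - (p.1 : ℝ)) * ‖lamPart₂ 2 (vecT p.2)‖ ^ 2 + (p.1 : ℝ) / 2) / ‖lamPart₂ 2 (vecT p.2)‖ :=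
      ((((continuous_const.sub ht).mul (hp.norm.pow 2)).add (ht.div_const _)).sqrt).div
        hp.norm fun p => (norm_parts_pos_T p.2).1.ne'
    have hc2 : Continuous fun p : I × ↥tubeSeam =>
        Real.sqrt ((1 - (p.1 : ℝ)) * ‖muPartG 2 (vecT p.2)‖ ^ 2 + (p.1 : ℝ) / 2) / ‖muPartG 2 (vecT p.2)‖ :=
      ((((continuous_const.sub ht).mul (hq.norm.pow 2)).add (ht.div_const _)).sqrt).div
        hq.norm fun p => (norm_parts_pos_T p.2).2.ne'
    exact ((lamEmbed₂ 2).continuous.comp (hc1.smul hp)).add ((muEmbedG 2).continuous.comp (hc2.smul hq))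
  map_zero_left y := by
    apply ext_vecT
    rw [vecT_defPtT]
    show lamEmbed₂ 2 (defLamT 0 y) + muEmbedG 2 (defMuT 0 y) = vecT y
    obtain ⟨hp, hq⟩ := norm_parts_pos_T y
    rw [defLamT, defMuT]
    simp only [sub_zero, one_mul, zero_div, add_zero]
    rw [Real.sqrt_sq hp.le, Real.sqrt_sq hq.le, div_self hp.ne', div_self hq.ne', one_smul, one_smul,
      lamEmbed₂_lamPart₂_add_muEmbedG_muPartG]
  map_one_left y := by
    apply ext_vecT
    rw [vecT_defPtT]
    show lamEmbed₂ 2 (defLamT 1 y) + muEmbedG 2 (defMuT 1 y) = cliffordVec _ _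
    rw [cliffordVec_eq, defLamT, defMuT]
    simp only [sub_self, zero_mul, zero_add, one_div, Real.sqrt_inv]
    show lamEmbed₂ 2 (((Real.sqrt 2)⁻¹ / ‖lamPart₂ 2 (vecT y)‖) • lamPart₂ 2 (vecT y)) +
        muEmbedG 2 (((Real.sqrt 2)⁻¹ / ‖muPartG 2 (vecT y)‖) • muPartG 2 (vecT y)) =
      lamEmbed₂ 2 ((Real.sqrt 2)⁻¹ • (‖lamPart₂ 2 (vecT y)‖⁻¹ • lamPart₂ 2 (vecT y))) +
        muEmbedG 2 ((Real.sqrt 2)⁻¹ • (‖muPartG 2 (vecT y)‖⁻¹ • muPartG 2 (vecT y)))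
    rw [smul_smul, smul_smul, div_eq_mul_inv, div_eq_mul_inv]

end Deformation

/-! ## §2 Homology: spanned by the meridian and the longitude -/

section Homology

/-- **Two-generator Hurewicz**: if `π₁(P, x₀) = {[L₁]^m [L₂]^n}` then every class of `H₁(P; ℤ)` is
`a • h(L₁) + b • h(L₂)` (`P` path connected). [cite: HatcherAT2002, Thm. 2A.1] -/
theorem exists_eq_pair_of_zpow_mul_zpow {P : Type} [TopologicalSpace P] [PathConnectedSpace P]
    {x₀ : P} (L₁ L₂ : Path x₀ x₀)
    (hL : ∀ γ : Path x₀ x₀, ∃ m n : ℤ, FundamentalGroup.fromPath (Path.Homotopic.Quotient.mk γ) =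
      FundamentalGroup.fromPath (Path.Homotopic.Quotient.mk L₁) ^ m *
        FundamentalGroup.fromPath (Path.Homotopic.Quotient.mk L₂) ^ n)
    (c : singularHomology ℤ ℤ P 1) :
    ∃ a b : ℤ, c = a • loopClass ℤ ℤ (1 : ℤ) L₁ + b • loopClass ℤ ℤ (1 : ℤ) L₂ := by
  have hspan : Submodule.span ℤ (Set.range fun γ : Path x₀ x₀ => loopClass ℤ ℤ (1 : ℤ) γ) ≤
      Submodule.span ℤ {loopClass ℤ ℤ (1 : ℤ) L₁, loopClass ℤ ℤ (1 : ℤ) L₂} := by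
    rw [Submodule.span_le]
    rintro _ ⟨γ, rfl⟩
    obtain ⟨m, n, hmn⟩ := hL γ
    have h := congrArg (fun g => Multiplicative.toAdd (hurewiczOne ℤ ℤ (1 : ℤ) x₀ g)) hmn
    simp only [map_mul, map_zpow, hurewiczOne_fromPath, toAdd_ofAdd, toAdd_mul, toAdd_zpow] at h
    change loopClass ℤ ℤ (1 : ℤ) γ ∈ _
    rw [h]
    have h1 : loopClass ℤ ℤ (1 : ℤ) L₁ ∈
        Submodule.span ℤ {loopClass ℤ ℤ (1 : ℤ) L₁, loopClass ℤ ℤ (1 : ℤ) L₂} :=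
      Submodule.subset_span (Set.mem_insert _ _)
    have h2 : loopClass ℤ ℤ (1 : ℤ) L₂ ∈
        Submodule.span ℤ {loopClass ℤ ℤ (1 : ℤ) L₁, loopClass ℤ ℤ (1 : ℤ) L₂} :=
      Submodule.subset_span (Set.mem_insert_of_mem _ (Set.mem_singleton _))
    exact Submodule.add_mem _ (zsmul_mem h1 m) (zsmul_mem h2 n)
  have hc : c ∈ Submodule.span ℤ {loopClass ℤ ℤ (1 : ℤ) L₁, loopClass ℤ ℤ (1 : ℤ) L₂} := by
    apply hspan
    rw [HurewiczProof.span_loopClass_eq_top x₀]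
    exact Submodule.mem_top
  obtain ⟨a, b, hab⟩ := Submodule.mem_span_pair.1 hc
  refine ⟨a, b, ?_⟩
  rw [← hab]
  exact congrArg₂ (· + ·) (int_smul_eq_zsmul _ a _) (int_smul_eq_zsmul _ b _)

/-- The circle as the subspace `univ` of itself (the form of Thm. 1.7 in the tree). [folklore] -/
abbrev UCirc : Type := ↥(Set.univ : Set (Metric.sphere (0 : EuclideanSpace ℝ (Fin 2)) 1))

/-- The base point `e^{0}` of `UCirc`. [folklore] -/
abbrev ub : UCirc := ⟨circlePt 0, mem_univ _⟩

/-- The standard loop of `UCirc`. [folklore] -/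
abbrev uLoop : Path ub ub :=
  liftPath univ (loopPath (id : sphere (0 : EuclideanSpace ℝ (Fin 2)) 1 → _) continuous_id)
    fun _ => mem_univ _

/-- **`π₁(𝕊¹)` is generated by the standard loop** (simple closed curve `circlePt`). [cite: HatcherAT2002, Thm. 1.7] -/
theorem exists_zpow_uLoop (x : FundamentalGroup UCirc ub) : ∃ n : ℤ,
    x = FundamentalGroup.fromPath (Path.Homotopic.Quotient.mk uLoop) ^ n := by
  have hgen : Subgroup.zpowers (FundamentalGroup.fromPath (Path.Homotopic.Quotient.mk uLoop)) = ⊤ :=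
    zpowers_liftPath_eq_top_of_simpleClosed
      (loopPath (id : sphere (0 : EuclideanSpace ℝ (Fin 2)) 1 → _) continuous_id)
      circlePt_eq_iff (S := (univ : Set (sphere (0 : EuclideanSpace ℝ (Fin 2)) 1))) (fun _ => mem_univ _)
      (fun θ _ => by obtain ⟨t, rfl⟩ := exists_circlePt_eq θ; exact ⟨t, rfl⟩) (mem_univ _)
  have hm : x ∈ Subgroup.zpowers (FundamentalGroup.fromPath (Path.Homotopic.Quotient.mk uLoop)) := by
    rw [hgen]; exact Subgroup.mem_top _
  obtain ⟨n, hn⟩ := Subgroup.mem_zpowers_iff.1 hm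
  exact ⟨n, hn.symm⟩

/-- **Every loop of the torus `UCirc × UCirc` is `[(ω, b₀)]^m [(b₀, ω)]^n`** (Hatcher Prop. 1.12 with Thm. 1.7).
[cite: HatcherAT2002, Prop. 1.12 (p. 34)] -/
theorem exists_zpow_mul_zpow_torus (γ : Path ((ub, ub) : UCirc × UCirc) (ub, ub)) : ∃ m n : ℤ,
    FundamentalGroup.fromPath (Path.Homotopic.Quotient.mk γ) =
      FundamentalGroup.fromPath (Path.Homotopic.Quotient.mk (uLoop.prod (Path.refl ub))) ^ m *
        FundamentalGroup.fromPath (Path.Homotopic.Quotient.mk ((Path.refl ub).prod uLoop)) ^ n := by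
  set e := fundamentalGroupProdEquiv ub ub with he
  obtain ⟨m, hm⟩ := exists_zpow_uLoop (e (FundamentalGroup.fromPath (Path.Homotopic.Quotient.mk γ))).1
  obtain ⟨n, hn⟩ := exists_zpow_uLoop (e (FundamentalGroup.fromPath (Path.Homotopic.Quotient.mk γ))).2
  have h1 : FundamentalGroup.fromPath (Path.Homotopic.Quotient.mk (Path.refl ub)) = 1 := by
    rw [Path.Homotopic.Quotient.mk_refl]; rfl
  have hL : e (FundamentalGroup.fromPath (Path.Homotopic.Quotient.mk (uLoop.prod (Path.refl ub)))) =
      (FundamentalGroup.fromPath (Path.Homotopic.Quotient.mk uLoop), 1) := by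
    rw [← h1, he, ← fundamentalGroupProdEquiv_symm_apply_mk, MulEquiv.apply_symm_apply]
  have hR : e (FundamentalGroup.fromPath (Path.Homotopic.Quotient.mk ((Path.refl ub).prod uLoop))) =
      (1, FundamentalGroup.fromPath (Path.Homotopic.Quotient.mk uLoop)) := by
    rw [← h1, he, ← fundamentalGroupProdEquiv_symm_apply_mk, MulEquiv.apply_symm_apply]
  refine ⟨m, n, e.injective ?_⟩
  rw [map_mul, map_zpow, map_zpow, hL, hR, Prod.ext_iff]
  simp only [Prod.fst_mul, Prod.snd_mul, Prod.pow_fst, Prod.pow_snd, one_zpow, mul_one, one_mul]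
  exact ⟨hm, hn⟩

/-- On `H₁` the deformation end `cliff ∘ angs` acts as the identity. [cite: HatcherAT2002, Thm. 2.10] -/
theorem map_cliff_comp_angs_apply (c : singularHomology ℤ ℤ ↥tubeSeam 1) :
    singularHomology.map ℤ ℤ cliff 1 (singularHomology.map ℤ ℤ angs 1 c) = c := by
  rw [← ModuleCat.comp_apply, ← singularHomology.map_comp,
    ← singularHomology.map_eq_of_homotopic ℤ ℤ ⟨cliffHomotopy⟩, singularHomology.map_id]
  rfl

/-- The Clifford torus read on `UCirc × UCirc`. [folklore] -/
abbrev cliffU : C(UCirc × UCirc, ↥tubeSeam) :=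
  cliff.comp ((⟨Subtype.val, continuous_subtype_val⟩ : C(UCirc, (sphere (0 : EuclideanSpace ℝ (Fin 2)) 1))).prodMap
    (⟨Subtype.val, continuous_subtype_val⟩ : C(UCirc, (sphere (0 : EuclideanSpace ℝ (Fin 2)) 1))))

/-- **`H₁(tubeSeam; ℤ)` comes from the torus**: `cliffU_*` is onto. [cite: HatcherAT2002, Thm. 2.10] -/
theorem surjective_map_cliffU : Function.Surjective (singularHomology.map ℤ ℤ cliffU 1) := by
  intro c
  have hs : Function.Surjective (singularHomology.map ℤ ℤ
      ((⟨Subtype.val, continuous_subtype_val⟩ : C(UCirc, (sphere (0 : EuclideanSpace ℝ (Fin 2)) 1))).prodMap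
        (⟨Subtype.val, continuous_subtype_val⟩ : C(UCirc, (sphere (0 : EuclideanSpace ℝ (Fin 2)) 1)))) 1) := by
    rw [show ((⟨Subtype.val, continuous_subtype_val⟩ : C(UCirc, (sphere (0 : EuclideanSpace ℝ (Fin 2)) 1))).prodMap
        (⟨Subtype.val, continuous_subtype_val⟩ : C(UCirc, (sphere (0 : EuclideanSpace ℝ (Fin 2)) 1)))) =
        (((Homeomorph.Set.univ (sphere (0 : EuclideanSpace ℝ (Fin 2)) 1)).prodCongr
          (Homeomorph.Set.univ (sphere (0 : EuclideanSpace ℝ (Fin 2)) 1))) : C(_, _)) from rfl,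
      ← singularHomology.mapIso_hom]
    exact ((ConcreteCategory.isIso_iff_bijective _).1 inferInstance).2
  obtain ⟨z, hz⟩ := hs (singularHomology.map ℤ ℤ angs 1 c)
  refine ⟨z, ?_⟩
  show singularHomology.map ℤ ℤ (cliff.comp _) 1 z = c
  rw [singularHomology.map_comp, ModuleCat.comp_apply, hz, map_cliff_comp_angs_apply]

/-- **(T2) Every class of `H₁(tubeSeam; ℤ)` is `a[meridian] + b[longitude]`.** [cite: Kas1980] -/
theorem Kas_tubeSeam_generated (c : singularHomology ℤ ℤ ↥tubeSeam 1) : ∃ a b : ℤ,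
    c = a • loopClass ℤ ℤ (1 : ℤ) (loopPath modelMer continuous_modelMer) +
      b • loopClass ℤ ℤ (1 : ℤ) (loopPath modelLong continuous_modelLong) := by
  haveI : PathConnectedSpace (sphere (0 : EuclideanSpace ℝ (Fin 2)) 1) := by
    refine isPathConnected_iff_pathConnectedSpace.mp (isPathConnected_sphere ?_ _ zero_le_one)
    rw [← Module.finrank_eq_rank, finrank_euclideanSpace_fin]
    norm_num
  haveI : PathConnectedSpace UCirc :=
    (Homeomorph.Set.univ _).symm.surjective.pathConnectedSpace (Homeomorph.Set.univ _).symm.continuous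
  obtain ⟨z, rfl⟩ := surjective_map_cliffU c
  obtain ⟨a, b, rfl⟩ := exists_eq_pair_of_zpow_mul_zpow_torus_aux z
  refine ⟨b, a, ?_⟩
  have e1 : singularHomology.map ℤ ℤ cliffU 1 (loopClass ℤ ℤ (1 : ℤ) (uLoop.prod (Path.refl ub))) =
      loopClass ℤ ℤ (1 : ℤ) (loopPath modelLong continuous_modelLong) := by
    rw [map_loopClass]; exact loopClass_eq_of_coe_eq ℤ _ _ (funext fun t => rfl)
  have e2 : singularHomology.map ℤ ℤ cliffU 1 (loopClass ℤ ℤ (1 : ℤ) ((Path.refl ub).prod uLoop)) =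
      loopClass ℤ ℤ (1 : ℤ) (loopPath modelMer continuous_modelMer) := by
    rw [map_loopClass]; exact loopClass_eq_of_coe_eq ℤ _ _ (funext fun t => rfl)
  have e3 := map_add (singularHomology.map ℤ ℤ cliffU 1).hom
    (a • loopClass ℤ ℤ (1 : ℤ) (uLoop.prod (Path.refl ub))) (b • loopClass ℤ ℤ (1 : ℤ) ((Path.refl ub).prod uLoop))
  rw [map_zsmul, map_zsmul] at e3
  refine (e3.trans ?_ : _)
  change a • singularHomology.map ℤ ℤ cliffU 1 _ + b • singularHomology.map ℤ ℤ cliffU 1 _ = _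
  rw [e1, e2]
  exact add_comm _ _
where
  /-- the torus classes are pairs -/
  exists_eq_pair_of_zpow_mul_zpow_torus_aux [PathConnectedSpace UCirc]
      (z : singularHomology ℤ ℤ (UCirc × UCirc) 1) : ∃ a b : ℤ,
      z = a • loopClass ℤ ℤ (1 : ℤ) (uLoop.prod (Path.refl ub)) +
        b • loopClass ℤ ℤ (1 : ℤ) ((Path.refl ub).prod uLoop) :=
    exists_eq_pair_of_zpow_mul_zpow _ _ exists_zpow_mul_zpow_torus z

/-- **(T1) Every point of the tube seam is joined to the Clifford base point** (deform onto the Clifford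
torus, an image of the path-connected torus). [folklore] -/
theorem joined_cliff_base (y : ↥tubeSeam) : Joined y (cliff (baseAngle, baseAngle)) := by
  haveI : PathConnectedSpace (sphere (0 : EuclideanSpace ℝ (Fin 2)) 1) := by
    refine isPathConnected_iff_pathConnectedSpace.mp (isPathConnected_sphere ?_ _ zero_le_one)
    rw [← Module.finrank_eq_rank, finrank_euclideanSpace_fin]
    norm_num
  have h1 : Joined y (cliff (angs y)) := ⟨cliffHomotopy.evalAt y⟩
  exact h1.trans ⟨(PathConnectedSpace.somePath (angs y) (baseAngle, baseAngle)).map cliff.continuous⟩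

end Homology

/-! ## §3 The design statement -/

/-- **(D-tube) `Kas_tubeSeam_homology`** (= registered sub-goal stub `stub_Kas_tubeSeam_homology` of
`stub_modelsOn_counts`): the tube seam `(T ∖ S) ∩ S³ ≅ T² × ℝ` is path connected and its first
homology is spanned by the model meridian and longitude. [cite: Kas1980] -/
theorem Kas_tubeSeam_homology :
    IsPathConnected (tubeSeam : Set ↥(handleTube 3 2)) ∧
    ∀ c : singularHomology ℤ ℤ ↥tubeSeam 1, ∃ a b : ℤ,
      c = a • loopClass ℤ ℤ (1 : ℤ) (loopPath modelMer continuous_modelMer) +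
        b • loopClass ℤ ℤ (1 : ℤ) (loopPath modelLong continuous_modelLong) :=
  ⟨isPathConnected_iff_pathConnectedSpace.2 ⟨⟨cliff (baseAngle, baseAngle)⟩, fun x y =>
    (joined_cliff_base x).trans (joined_cliff_base y).symm⟩, Kas_tubeSeam_generated⟩

/-- **(D-tube) registered sub-goal stub `stub_Kas_tubeSeam_homology`** of `stub_modelsOn_counts`
(design lemma `Kas_tubeSeam_homology` verbatim). [cite: Kas1980] -/
theorem stub_Kas_tubeSeam_homology :
    IsPathConnected (tubeSeam : Set ↥(Literature.Topology.FourManifolds.handleTube 3 2)) ∧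
    ∀ c : Literature.AlgebraicTopology.SingularHomology.singularHomology ℤ ℤ ↥tubeSeam 1, ∃ a b : ℤ,
      c = a • Literature.AlgebraicTopology.SingularHomology.loopClass ℤ ℤ (1 : ℤ)
        (Literature.Topology.FourManifolds.LefschetzBase.loopPath modelMer continuous_modelMer) +
        b • Literature.AlgebraicTopology.SingularHomology.loopClass ℤ ℤ (1 : ℤ)
          (Literature.Topology.FourManifolds.LefschetzBase.loopPath modelLong continuous_modelLong) :=
  Kas_tubeSeam_homology

end Summit.SmoothPoincare4.SmoothPoincare4.Theorems.AcyclicBisectionExists.ModpBraidOrbits
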